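import Summits.Ventures.CertifiedManyBodySolver.Certificates.HubbardSquare_electronDoped_docc_boxes_mirror
import Summits.Ventures.CertifiedManyBodySolver.Certificates.HubbardSquare_U8_n1o2_chord_apriori_r498
import HarnessLib
import HarnessLib.Audit

/-!
# Ventures/CertifiedManyBodySolver — Certificates/HubbardSquare_electronDoped_n3o2_boxes_mirror.lean

HONEST FRAMING: a-priori kinetic / docc CONTROL cells and the floor OF the f-sum class of stiffness ceilings at THREE-QUARTER filling
`(U, n, t') = (8, 3/2, 0)`, obtained from the quarter-filled `(8, 1/2, 0)` cells by an exact symmetry; dictionary class; no stiffness floor exists in this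
class; not informative vs print; not a superconductivity or `T_c` verdict; no phase sentence.

Cell `hubbard-obs` (D-0042), seat p2 (stiffness), `prover-hubbard-obs-p2-g16-0`; part 6 of the g16 particle–hole files. ZERO compute; no definition; no
named fact; no `sorry`; the ONLY claim node is #498 (`cert_r498_qfp_U8_n1o2_tp0_upper`), taken BY NAME through the `(8, 1/2, 0)` theorems of
`Certificates/HubbardSquare_U8_n1o2_chord_apriori_r498.lean`. Mechanism: `torusLimit_kinetic_particleHole_pullback_of_dvd` / `negKinetic_classFloor_particleHole`
(part 2) and `torusLimit_docc_particleHole_pullback_of_dvd` (part 3) with `n = 3/2`, `q = 2`, `m = 3` (`(3/2)·2² = 2·3`: EVERY EVEN side is good).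

* `n3o2_U8_kinetic_box_of` — along even sides, every torus-limit ground state of the record class at `(8, 3/2, 0)` has
  `0.9916692317 ≤ −k ≤ 1.3148398202` (twin of `u8_n1o2_tp0_negKinetic_ge_cap_r498` ∧ `…_le_leaf`);
* `n3o2_U8_fsumStiffnessCeiling_classFloor_of` — every kinetic ceiling `X` certified on the record class at `(8, 3/2, 0)` (any side sequence) has
  `X ≥ 0.9916692317`, `X/4 ≥ 0.2479173`: no f-sum-route stiffness ceiling at three-quarter filling below the quarter-filling class floor;
* `n3o2_U8_docc_le_chord_of` — `d − 1/2 ≤ 646341177/16·10⁹` (`≤ 0.0403964`), i.e. `d(8, 3/2, 0) ≤ 0.5403964` along even sides (twin of the free-chord docc ceiling).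
The stiffness leaf itself at `(U, 3/2, 0)`: `≤ 0.3287100` UNRESTRICTED (part 5, `ObsStiffnessSeqCeilingAt_tp0_density_three_div_two`).

References: E. H. Lieb, F. Y. Wu, Physica A 321 (2003) 1, §1 eq. (3) [LiebWuPhysicaA2003]; R. B. Griffiths, J. Math. Phys. 7 (1966) 1215, §II [Griffiths1966];
D. J. Scalapino, S. R. White, S.-C. Zhang, PRB 47 (1993) 7995, §II [ScalapinoWhiteZhang1993].
-/

noncomputable section

namespace Summit.Ventures.CertifiedManyBodySolver.Certificates

open Literature.MathematicalPhysics.QuantumLattice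
open Literature.MathematicalPhysics.QuantumLattice.ThermodynamicLimit
open Literature.Probability.LatticeModels
open Summit.Ventures.CertifiedManyBodySolver.Observables
open Matrix Finset Filter Topology
open scoped Matrix BigOperators ComplexOrder

/-- **Kinetic box at `(8, 3/2, 0)` along even sides**: `0.9916692317 ≤ −k(ω) ≤ 1.3148398202` for every torus-limit ground state of the record class at
`(8, 3/2, 0)` along eventually-even sides (twin of the `(8, 1/2, 0)` cap-only floor on #498 and of the quarter-filling kinematic ceiling; `(3/2)·2² = 2·3`).
[cite: LiebWuPhysicaA2003, §1 eq. (3)] [cite: Griffiths1966, §II] -/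
theorem n3o2_U8_kinetic_box_of (h498 : cert_r498_qfp_U8_n1o2_tp0_upper) :
    ∀ (ω : InfVolFermionState 2) (Ls : ℕ → ℕ) (ψ : ∀ L, Fock (Orb (FermionTorus 2 L))),
      Tendsto Ls atTop atTop → (∀ᶠ j in atTop, 2 ∣ Ls j) →
      (∀ j, IsGroundStateInSector (hubbardTorusTT' (Ls j) 1 0 8) (rectN (3 / 2) (Ls j)) 0 (ψ (Ls j))) →
      (∀ j, star (ψ (Ls j)) ⬝ᵥ ψ (Ls j) = 1) → ω.IsTorusLimitOf ψ Ls →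
      (((9916692317 / 10000000000 : ℚ)) : ℝ) ≤ -(∑ i : Fin 2, -(1 : ℝ) * ∑ σ : Fin 2,
          ((ω.expect {0, 0 + unitVec i}
              ((cAt 0 (mem_insert_self _ _) σ)ᴴ * cAt (0 + unitVec i) (mem_insert_of_mem (mem_singleton_self _)) σ)).re +
            (ω.expect {0, 0 + unitVec i}
              ((cAt (0 + unitVec i) (mem_insert_of_mem (mem_singleton_self _)) σ)ᴴ * cAt 0 (mem_insert_self _ _) σ)).re)) ∧
      -(∑ i : Fin 2, -(1 : ℝ) * ∑ σ : Fin 2,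
          ((ω.expect {0, 0 + unitVec i}
              ((cAt 0 (mem_insert_self _ _) σ)ᴴ * cAt (0 + unitVec i) (mem_insert_of_mem (mem_singleton_self _)) σ)).re +
            (ω.expect {0, 0 + unitVec i}
              ((cAt (0 + unitVec i) (mem_insert_of_mem (mem_singleton_self _)) σ)ᴴ * cAt 0 (mem_insert_self _ _) σ)).re)) ≤ (1.3148398202 : ℝ) :=
  torusLimit_kinetic_particleHole_pullback_of_dvd (U := 8) (n := 3 / 2) (by norm_num) (by norm_num) (q := 2) (m := 3)
    (by decide) (by norm_num)
    (P := fun x => (((9916692317 / 10000000000 : ℚ)) : ℝ) ≤ -x ∧ -x ≤ (1.3148398202 : ℝ))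
    (by
      rw [show (2 : ℝ) - 3 / 2 = 1 / 2 by norm_num]
      intro ω' Ls' ψ' hLs' hψ' h1' hω'
      exact ⟨u8_n1o2_tp0_negKinetic_ge_cap_r498 h498 ω' Ls' ψ' hLs' hψ' h1' hω',
        u8_n1o2_tp0_negKinetic_le_leaf ω' Ls' ψ' hLs' hψ' h1' hω'⟩)

/-- **Class floor at `(8, 3/2, 0)`** (UNRESTRICTED in the ceiling's side sequence): every real `X` bounding `−k` on the record torus-limit class at
`(8, 3/2, 0)` has `X ≥ 0.9916692317` and `X/4 ≥ 0.2479173` — the quarter-filling class floor holds verbatim at three-quarter filling.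
[cite: LiebWuPhysicaA2003, §1 eq. (3)] [cite: ScalapinoWhiteZhang1993, §II] -/
theorem n3o2_U8_fsumStiffnessCeiling_classFloor_of (h498 : cert_r498_qfp_U8_n1o2_tp0_upper) {X : ℝ}
    (hX : ∀ (ω : InfVolFermionState 2) (Ls : ℕ → ℕ) (ψ : ∀ L, Fock (Orb (FermionTorus 2 L))),
      Tendsto Ls atTop atTop →
      (∀ j, IsGroundStateInSector (hubbardTorusTT' (Ls j) 1 0 8) (rectN (3 / 2) (Ls j)) 0 (ψ (Ls j))) →
      (∀ j, star (ψ (Ls j)) ⬝ᵥ ψ (Ls j) = 1) → ω.IsTorusLimitOf ψ Ls → -(∑ i : Fin 2, -(1 : ℝ) * ∑ σ : Fin 2,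
          ((ω.expect {0, 0 + unitVec i}
              ((cAt 0 (mem_insert_self _ _) σ)ᴴ * cAt (0 + unitVec i) (mem_insert_of_mem (mem_singleton_self _)) σ)).re +
            (ω.expect {0, 0 + unitVec i}
              ((cAt (0 + unitVec i) (mem_insert_of_mem (mem_singleton_self _)) σ)ᴴ * cAt 0 (mem_insert_self _ _) σ)).re)) ≤ X) :
    (((9916692317 / 10000000000 : ℚ)) : ℝ) ≤ X ∧ (((2479173 / 10000000 : ℚ)) : ℝ) ≤ X / 4 := by
  have h := negKinetic_classFloor_particleHole (U := 8) (n := 1 / 2) (by norm_num) (by norm_num) (q := 2) (m := 1) (by decide)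
    (by norm_num) (by norm_num) (u8_n1o2_tp0_negKinetic_ge_cap_r498 h498)
    (by rw [show (2 : ℝ) - 1 / 2 = 3 / 2 by norm_num]; exact hX)
  refine ⟨h, ?_⟩
  have hlit : (((2479173 / 10000000 : ℚ)) : ℝ) ≤ (((9916692317 / 10000000000 : ℚ)) : ℝ) / 4 := by push_cast; norm_num
  linarith

/-- **Docc at `(8, 3/2, 0)` along even sides**: `d − 1/2 ≤ 646341177/16·10⁹` (`≤ 0.0403964`; twin of `u8_n1o2_tp0_docc_le_chord_free_r498`, the free-chord
docc ceiling at quarter filling; electron-doped reading `d ≤ 0.5403964`). [cite: LiebWuPhysicaA2003, §1 eq. (3)] [cite: Griffiths1966, §II] -/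
theorem n3o2_U8_docc_le_chord_of (h498 : cert_r498_qfp_U8_n1o2_tp0_upper) :
    ∀ (ω : InfVolFermionState 2) (Ls : ℕ → ℕ) (ψ : ∀ L, Fock (Orb (FermionTorus 2 L))),
      Tendsto Ls atTop atTop → (∀ᶠ j in atTop, 2 ∣ Ls j) →
      (∀ j, IsGroundStateInSector (hubbardTorusTT' (Ls j) 1 0 8) (rectN (3 / 2) (Ls j)) 0 (ψ (Ls j))) →
      (∀ j, star (ψ (Ls j)) ⬝ᵥ ψ (Ls j) = 1) → ω.IsTorusLimitOf ψ Ls →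
      (ω.expect ({0} : Finset (Site 2)) (doccAt0 2)).re - 1 / 2 ≤ (((646341177 / 16000000000 : ℚ)) : ℝ) := by
  have h := torusLimit_docc_particleHole_pullback_of_dvd (U := 8) (n := 3 / 2) (by norm_num) (by norm_num) (q := 2) (m := 3)
    (by decide) (by norm_num)
    (P := fun x => x ≤ (((646341177 / 16000000000 : ℚ)) : ℝ))
    (by
      rw [show (2 : ℝ) - 3 / 2 = 1 / 2 by norm_num]
      exact u8_n1o2_tp0_docc_le_chord_free_r498 h498)
  intro ω Ls ψ hLs hdvd hψ h1 hω
  have h' := h ω Ls ψ hLs hdvd hψ h1 hω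
  have hx : (ω.expect ({0} : Finset (Site 2)) (doccAt0 2)).re + (1 - 3 / 2) = (ω.expect ({0} : Finset (Site 2)) (doccAt0 2)).re - 1 / 2 := by ring
  rw [hx] at h'
  exact h'

/-- Literals (decidable): `0.9916692317/4 ≥ 0.2479173`; `646341177/16·10⁹ ≤ 0.0403964`, `+ 1/2 ≤ 0.5403964`; the box is non-empty (`0.9916692317 < 1.3148398202`).
[folklore] -/
theorem electronDoped_n3o2_literals :
    ((2479173 / 10000000 : ℚ) ≤ 9916692317 / 10000000000 / 4) ∧ ((646341177 / 16000000000 : ℚ) ≤ 403964 / 10000000) ∧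
      ((646341177 / 16000000000 : ℚ) + 1 / 2 ≤ 5403964 / 10000000) ∧ ((9916692317 / 10000000000 : ℚ) < 1.3148398202) := by
  norm_num

end Summit.Ventures.CertifiedManyBodySolver.Certificates
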